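import Mathlib
import Literature.Computability.Complexity.PolynomialSelfCorrection
import Literature.Computability.Complexity.ShenProtocolGame
import HarnessLib

/-!
# Function-restricted verification down a polynomial chain (Lund–Fortnow–Karloff–Nisan / Shamir):
# perfect completeness and the soundness count against a FIXED oracle (union and product forms,
# repetition)

Literature / complexity — the analysis half of the DOWNWARD CHECKER that Murray–Williams' Theorem 2.2
(SIAM Thm. 2.7, after Santhanam 2009, Lemma 12: "a `PSPACE`-complete language with
function-restricted interactive proofs where the prover only answers questions of the same length as
the input", following [LFKN92, Sha92, TV02, FS04]) asks of Trevisan–Vadhan's language, in the form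
`AlmostAE.SameLengthChecker.ofOnesZeroPad` (`OnesZeroPadding.lean`) consumes after padding: a
verifier for the claim `P i x = v` about a level of a chain of low-degree polynomials
`P 0, …, P m : (V → K) → K` with Trevisan–Vadhan's axis-line downward structure
(`P i x = c i x (P (i+1) (x[a i ↦ 0])) (P (i+1) (x[a i ↦ 1]))`, `TVFunction.Fni_eq_of_queries` /
`QBFUniv.fam_succ`), which only ever asks an ORACLE for values of the DEEPER levels `i+1, …, m`
(shorter words, in Trevisan–Vadhan's length layout) and evaluates the bottom level itself. The
protocol is Lund–Fortnow–Karloff–Nisan's (J. ACM 39 (1992), §3) / Shamir's, one stage per level as in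
Arora–Barak §8.3.2–8.3.3: read the prover's univariate restriction of `P (i+1)` along the axis
through `x` — here INTERPOLATED from the oracle's `δ + 1` answers at fixed nodes, the
function-restricted prover being a fixed function (Blum–Kannan; `InstanceChecker.lean`) — test
`c i x (q 0) (q 1) = v`, draw a challenge `r ∈ K`, continue from `P (i+1) (x[a i ↦ r]) = q r`.

* `ChainCheck.interp` (Lagrange through `δ + 1` nodes, Mathlib's `Lagrange.interpolate`) with
  `natDegree_interp_le`, `eq_interp_of_natDegree_le`, and `card_eval_eq_le` (two distinct
  polynomials of degree `≤ δ` agree on `≤ δ` points);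
* `ChainCheck.Chain` (levels `P`, axes `a`, rules `c`), the hypotheses `Chain.AxisDegree m δ` (axis
  restrictions of `P (i+1)`, `i < m`, have degree `≤ δ`; `Chain.axisDegree_of_totalDegree` derives it
  from total degree `≤ δ` through `PolySelfCorrect.linePoly`) and `Chain.Rule m`;
* **`Chain.accepts τ O j i x v rs`** — the verifier's verdict from the claim `P i x = v` with `j` more
  stages, challenges `rs ∈ Kʲ`, against the oracle `O : ℕ → (V → K) → K`;
* **`Chain.accepts_of_honest`** — PERFECT COMPLETENESS: with an oracle truthful on the levels
  `i+1, …, m` (for a downward checker: an oracle right on the shorter query lengths), a true claim is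
  accepted at every challenge vector;
* **`Chain.card_accepts_le`** — SOUNDNESS COUNT against every fixed oracle: from a false claim at
  most `bound |K| δ j = j · δ · |K|^{j-1}` of the `|K|ʲ` challenge vectors accept (Arora–Barak's
  Claim in the proof of Thm. 8.21, by induction on the stages: a passing consistency test forces
  `q ≠` the true restriction, so all but `≤ δ` challenges hand a false claim down), and
  **`Chain.prob_accepts_le`**: probability `≤ j δ / |K|`.

With ONE degree bound `δ` for all stages, a `1/3`-sound checker by the union bound needs
`|K| ≥ 3 m δ` — for Trevisan–Vadhan's schedule `m = mlen n = n (N n + 1)`, `δ = max 3 (2n)`, more than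
`TVFunction.lean`'s field offers (`|K n| ≤ 2 (Dn n + 1)`, `Dn n = N n · max 3 (2n)`). The second half
of the file is the analysis that works at that field (Arora–Barak's own form of the Claim, "`V`
rejects with probability at least `(1 - d/p)ⁿ`", with each stage's own `dᵢ`, plus repetition):

* `Chain.axisDegree_of_degreeOf` / `Chain.axisDegreeV_of_degreeOf` — the axis-degree hypotheses from
  the degree IN THE AXIS VARIABLE (`QBFArith.restrict`, `ShenProtocolGame.lean`), stage by stage
  (`Chain.AxisDegreeV δs m` with `δs : ℕ → ℕ`);
* `Chain.claimPoly`, **`Chain.acceptsV`** — the verifier reading `δs i + 1` nodes at level `i` (nodes: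
  an initial segment of a sequence `ν`, distinct where used, `Chain.NodesInj`), `Chain.acceptsV_of_honest`
  (perfect completeness), **`Chain.prod_le_card_rejectsV`** — PRODUCT-FORM SOUNDNESS COUNT: from a
  false claim at least `∏_{s<j} (|K| - δs (i+s))` challenge vectors reject — `Chain.card_acceptsV_add_prod_le`,
  `Chain.prob_acceptsV_le` (`≤ 1 - ∏ (1 - δᵢ/|K|)`);
* `exp_neg_le_one_sub` (`4^{-x} ≤ 1 - x` on `[0, 1/2]`, convexity of `exp`),
  `exp_neg_sum_le_prod_one_sub`, `one_div_le_prod_one_sub` (`Σ xᵢ ≤ 5/2 ⟹ ∏ (1 - xᵢ) ≥ 1/32`), hence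
  **`Chain.prob_acceptsV_le_const`**: at a field with `2 Σᵢ δᵢ ≤ 5 |K|` and `2 δᵢ ≤ |K|` a false claim
  is accepted with probability `≤ 31/32`;
* **`Chain.checksV`** — one run of a MEMBERSHIP checker (no claim in hand: the claim is the value the
  rule assigns to the oracle's first interpolant, tested against a predicate `good`, e.g. "bit `j` is
  `1`"; with no deeper level the run evaluates the level itself), `Chain.checksV_of_honest` (returns
  exactly `good (P i x)`), `Chain.card_checksV_add_prod_le`, `Chain.prob_checksV_le_const` (`≤ 31/32`
  when `good (P i x) = false`);
* `card_forall_mem_eq_pow`, `prob_forall_le_pow` (independent repetitions against a FIXED oracle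
  multiply), `const_pow_64_le` (`(31/32)⁶⁴ ≤ 1/3`) and **`Chain.prob_forall_checksV_le`**: sixty-four
  runs on independent challenge blocks, all required to accept, are `1/3`-sound.

For Trevisan–Vadhan's schedule the stage degrees are `1` (quantifier stages, after a linearization
sweep), `≤ 2n` (the sweep over the matrix) and `≤ 3` (the other sweeps), so `2 Σᵢ δᵢ ≤ 5 (Dn n + 2)
≤ 5 |K n|` (the instantiation is the sequel file). Not here: the oracle MACHINE realizing `checksV` on
Trevisan–Vadhan's words (field arithmetic on `GF2Str.bits`, `TVFieldBricks.lean`; coins = `64 j`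
field elements) and its query-length discipline — the other half of the checker. Everything is proved;
the definitions are plain functions and one structure (no named fact, D-0026). Mathlib has Lagrange
interpolation, root counting and convexity of `exp` (used), no interactive proofs; the tree's
`SumcheckIP*.lean` / `ShenProtocolGame.lean` analyse sumcheck / Shamir–Shen in the GAME model
(`gameValue`, adaptive provers), not against function-restricted provers (searched `accepts_of_honest`,
`card_accepts_le`, `function-restricted`, `ChainCheck`, `piFinset` repetition lemmas, 2026-08-15).

## References

* C. Lund, L. Fortnow, H. Karloff, N. Nisan, *Algebraic methods for interactive proof systems*,
  J. ACM 39 (1992) 859–868, §3 (the protocol; completeness; soundness by the root bound)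
  [LundEtAl1992].
* A. Shamir, *IP = PSPACE*, J. ACM 39 (1992) 869–877 [Shamir1992].
* S. Arora, B. Barak, *Computational Complexity: A Modern Approach*, CUP 2009, §8.3.2–8.3.3
  (Thm. 8.21 and its Claim, (8.10)), §7.4.1 (error reduction by repetition), §A.6 (polynomials:
  interpolation, root bound), §19.4.2 [AroraBarakCC2009].
* L. Trevisan, S. Vadhan, *Pseudorandomness and average-case complexity via uniform reductions*,
  Comput. Complexity 16 (2007), Lemma 4.1 (i), (iii); Thm. 5.4 [TrevisanVadhan2007].
* R. Santhanam, *Circuit lower bounds for Merlin–Arthur classes*, SIAM J. Comput. 39 (2009)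
  1038–1061, Lemma 12 [Santhanam2009].
* M. Blum, S. Kannan, *Designing programs that check their work*, J. ACM 42 (1995), §7
  (function-restricted provers are fixed functions).
-/

noncomputable section

namespace Literature.Computability.Complexity

namespace ChainCheck

open Finset Polynomial

/-! ### Interpolation facts -/

section Interp

variable {K : Type*} [Field K] {δ : ℕ} (τ : Fin (δ + 1) → K)

/-- The interpolant through the `δ + 1` nodes `τ` of a table of values (Lagrange). [cite: AroraBarakCC2009, §A.6 (Lagrange interpolation)] -/
def interp (w : Fin (δ + 1) → K) : K[X] := Lagrange.interpolate univ τ w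

/-- The interpolant has degree `≤ δ`. [cite: AroraBarakCC2009, §A.6] -/
theorem natDegree_interp_le (hτ : Function.Injective τ) (w : Fin (δ + 1) → K) :
    (interp τ w).natDegree ≤ δ := by
  have h := Lagrange.degree_interpolate_lt w (hτ.injOn (s := (univ : Finset (Fin (δ + 1)))))
  rw [card_univ, Fintype.card_fin] at h
  by_cases hq : interp τ w = 0
  · rw [hq, natDegree_zero]; exact Nat.zero_le _
  · exact Nat.lt_succ_iff.1 ((natDegree_lt_iff_degree_lt hq).2 h)

/-- A polynomial of degree `≤ δ` is the interpolant of its values at the `δ + 1` nodes. [cite: AroraBarakCC2009, §A.6] -/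
theorem eq_interp_of_natDegree_le (hτ : Function.Injective τ) {q : K[X]} (hq : q.natDegree ≤ δ) :
    q = interp τ fun l => q.eval (τ l) := by
  refine Lagrange.eq_interpolate (hτ.injOn (s := (univ : Finset (Fin (δ + 1))))) ?_
  rw [card_univ, Fintype.card_fin]
  exact (degree_le_natDegree.trans (WithBot.coe_le_coe.2 hq)).trans_lt (WithBot.coe_lt_coe.2 (Nat.lt_succ_self δ))

/-- Two distinct polynomials of degree `≤ δ` agree on at most `δ` field elements.
[cite: AroraBarakCC2009, §A.6 (a nonzero degree-d polynomial has at most d roots)] -/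
theorem card_eval_eq_le [Fintype K] [DecidableEq K] {p q : K[X]} (hp : p.natDegree ≤ δ) (hq : q.natDegree ≤ δ)
    (hpq : p ≠ q) : #{r : K | p.eval r = q.eval r} ≤ δ := by
  have hne : p - q ≠ 0 := sub_ne_zero.2 hpq
  have hsub : (univ.filter fun r : K => p.eval r = q.eval r) ⊆ (p - q).roots.toFinset := by
    intro r hr
    rw [mem_filter] at hr
    rw [Multiset.mem_toFinset, mem_roots hne, IsRoot, eval_sub, hr.2, sub_self]
  calc #{r : K | p.eval r = q.eval r} ≤ (p - q).roots.toFinset.card := card_le_card hsub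
    _ ≤ Multiset.card (p - q).roots := Multiset.toFinset_card_le _
    _ ≤ (p - q).natDegree := card_roots' _
    _ ≤ δ := (natDegree_sub_le p q).trans (max_le hp hq)

end Interp

/-! ### Counting helpers -/

/-- Counting over `α × αʲ`: the vectors of `α^{j+1}` with a property, split by their first entry. [folklore] -/
theorem card_filter_succ_eq_sum {α : Type*} [Fintype α] {j : ℕ} (Q : (Fin (j + 1) → α) → Bool) :
    #{rs : Fin (j + 1) → α | Q rs = true} = ∑ r : α, #{t : Fin j → α | Q (Fin.cons r t) = true} := by
  classical
  -- re-index along `Fin.cons : α × αʲ ≃ α^{j+1}`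
  have h1 : #{rs : Fin (j + 1) → α | Q rs = true} = #{p : α × (Fin j → α) | Q (Fin.cons p.1 p.2) = true} := by
    refine (card_bij' (fun p _ => Fin.cons p.1 p.2) (fun rs _ => (rs 0, Fin.tail rs)) ?_ ?_ ?_ ?_).symm
    · intro p hp
      simpa using hp
    · intro rs hrs
      simpa [Fin.cons_self_tail] using hrs
    · intro p _
      simp
    · intro rs _
      simp [Fin.cons_self_tail]
  rw [h1, card_eq_sum_ones, ← univ_product_univ, sum_filter, sum_product]
  refine sum_congr rfl fun r _ => ?_
  rw [card_eq_sum_ones, sum_filter]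

/-- The soundness bound `B j = j · δ · q^{j-1}` on the number of accepting challenge vectors in
`Kʲ`, `q = |K|`, from a false claim. [cite: AroraBarakCC2009, Thm. 8.21 (Claim, (8.10))] -/
def bound (q δ j : ℕ) : ℕ := j * δ * q ^ (j - 1)

/-- The recursion of the bound: `B (j+1) = δ qʲ + q · B j`. [folklore] -/
theorem bound_succ (q δ j : ℕ) : bound q δ (j + 1) = δ * q ^ j + q * bound q δ j := by
  unfold bound
  cases j with
  | zero => simp
  | succ j => rw [Nat.add_sub_cancel, Nat.add_sub_cancel, pow_succ]; ring

/-! ### The chain and its verifier -/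

/-- The data of a **polynomial chain with axis-line downward structure**: levels
`P 0, P 1, … : (V → K) → K`, and for each level `i` an axis `a i` and a combination rule `c i`
(`P i x` is `c i x` of the two values of `P (i+1)` at `x` with coordinate `a i` set to `0` and `1`;
Trevisan–Vadhan's `f_{n,i} = op_i (f_{n,i+1})`, `TVFunction.Fni_eq_of_queries` / `QBFUniv.fam_succ`).
[cite: TrevisanVadhan2007, Lemma 4.1 (i)] -/
structure Chain (K : Type*) (V : Type*) where
  /-- the levels -/
  P : ℕ → (V → K) → K
  /-- the axis of the downward step at level `i` -/
  a : ℕ → V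
  /-- the combination rule at level `i` (may read the whole point) -/
  c : ℕ → (V → K) → K → K → K

namespace Chain

variable {K : Type*} [Field K] [DecidableEq K] {V : Type*} [DecidableEq V]
variable (C : Chain K V) {δ : ℕ} (τ : Fin (δ + 1) → K)

/-- **The verifier's acceptance predicate** from the claim `P i x = v` with `j` more stages and
challenges `rs ∈ Kʲ`, against the oracle `O` (claimed values of the levels at points): read the
`δ + 1` claimed values of level `i + 1` on the axis line through `x` at the nodes, interpolate `q`,
reject unless `c i x (q 0) (q 1) = v`, and continue from the claim `P (i+1) (x[a i ↦ r]) = q r` at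
the challenge `r`; after the last stage compare with the level itself (the verifier evaluates the
bottom level on its own). [cite: LundEtAl1992, §3 (the protocol)] [cite: AroraBarakCC2009, §8.3.2 (sumcheck protocol), §8.3.3] -/
def accepts (O : ℕ → (V → K) → K) : (j : ℕ) → ℕ → (V → K) → K → (Fin j → K) → Bool
  | 0, i, x, v, _ => decide (C.P i x = v)
  | j + 1, i, x, v, rs =>
      let q := interp τ fun l => O (i + 1) (Function.update x (C.a i) (τ l))
      decide (C.c i x (q.eval 0) (q.eval 1) = v) &&
        accepts O j (i + 1) (Function.update x (C.a i) (rs 0)) (q.eval (rs 0)) (Fin.tail rs)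

/-- Unfolding at a `Fin.cons` challenge vector. [folklore] -/
theorem accepts_succ_cons (O : ℕ → (V → K) → K) (j i : ℕ) (x : V → K) (v r : K) (t : Fin j → K) :
    C.accepts τ O (j + 1) i x v (Fin.cons r t) =
      (decide (C.c i x ((interp τ fun l => O (i + 1) (Function.update x (C.a i) (τ l))).eval 0)
          ((interp τ fun l => O (i + 1) (Function.update x (C.a i) (τ l))).eval 1) = v) &&
        C.accepts τ O j (i + 1) (Function.update x (C.a i) r)
          ((interp τ fun l => O (i + 1) (Function.update x (C.a i) (τ l))).eval r) t) := by
  simp only [accepts, Fin.cons_zero, Fin.tail_cons]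

/-! ### Hypotheses on the chain -/

/-- **Axis-line low degree**: at every level `i < m`, the restriction of `P (i+1)` to the line
through any point along the axis `a i` is a polynomial of degree `≤ δ` (for Trevisan–Vadhan's
family: `degreeOf (a i) f_{n,i+1} ≤ max 3 (2n)`, `QBFUniv.degreeOf_fam_le`).
[cite: TrevisanVadhan2007, Lemma 4.1 (iii)] -/
def AxisDegree (m δ : ℕ) : Prop :=
  ∀ i < m, ∀ x : V → K, ∃ q : K[X], q.natDegree ≤ δ ∧
    ∀ t : K, C.P (i + 1) (Function.update x (C.a i) t) = q.eval t

/-- **The downward rule**: `P i x = c i x (P (i+1) (x[a i ↦ 0])) (P (i+1) (x[a i ↦ 1]))` for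
`i < m`. [cite: TrevisanVadhan2007, Lemma 4.1 (i)] -/
def Rule (m : ℕ) : Prop :=
  ∀ i < m, ∀ x : V → K,
    C.P i x = C.c i x (C.P (i + 1) (Function.update x (C.a i) 0)) (C.P (i + 1) (Function.update x (C.a i) 1))

/-! ### Completeness -/

/-- **Perfect completeness**: against an oracle that answers the levels `i+1, …, m` truthfully (the
honest prover; for a downward checker, an oracle correct on the SHORTER query lengths), a true claim
`P i x = v` is accepted at every challenge vector. [cite: LundEtAl1992, §3 (completeness)] [cite: AroraBarakCC2009, Thm. 8.21 (proof: "the prover can make V accept with probability 1")] -/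
theorem accepts_of_honest {m : ℕ} (hτ : Function.Injective τ) (hdeg : C.AxisDegree m δ) (hrule : C.Rule m)
    (O : ℕ → (V → K) → K) :
    ∀ (j i : ℕ), i + j ≤ m → (∀ i', i < i' → i' ≤ m → ∀ y, O i' y = C.P i' y) →
      ∀ (x : V → K) (rs : Fin j → K), C.accepts τ O j i x (C.P i x) rs = true
  | 0, i, _, _, x, rs => by simp [accepts]
  | j + 1, i, hij, hO, x, rs => by
    have him : i < m := by omega
    obtain ⟨q, hq, hqP⟩ := hdeg i him x
    -- the interpolant of the honest answers is the true restriction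
    have hinterp : (interp τ fun l => O (i + 1) (Function.update x (C.a i) (τ l))) = q := by
      have hvals : (fun l => O (i + 1) (Function.update x (C.a i) (τ l))) = fun l => q.eval (τ l) := by
        funext l
        rw [hO (i + 1) (Nat.lt_succ_self i) (by omega), hqP]
      rw [hvals]
      exact (eq_interp_of_natDegree_le τ hτ hq).symm
    rw [← Fin.cons_self_tail rs, accepts_succ_cons, hinterp, Bool.and_eq_true, decide_eq_true_eq,
      ← hqP 0, ← hqP 1, ← hqP (rs 0)]
    refine ⟨(hrule i him x).symm, ?_⟩
    exact accepts_of_honest hτ hdeg hrule O j (i + 1) (by omega)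
      (fun i' hi' hi'm y => hO i' (by omega) hi'm y) _ _

/-! ### Soundness against a fixed oracle -/

/-- **Soundness against a fixed oracle** (the Claim in the proof of Arora–Barak Thm. 8.21, for a
FUNCTION-restricted prover, whose round-`i` polynomial is interpolated from its fixed answers before
the challenge is drawn): from a FALSE claim `P i x = v`, at most `j · δ · |K|^{j-1}` of the `|K|ʲ`
challenge vectors accept — if the interpolated `q` passes the consistency test it differs from the
true restriction (`Rule`), so all but `≤ δ` challenges lead to a false claim one level down
(`card_eval_eq_le`), where induction applies. [cite: LundEtAl1992, §3 (soundness)] [cite: AroraBarakCC2009, Thm. 8.21 (Claim: "V rejects with probability at least (1 - d/p)ⁿ"; (8.10))] -/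
theorem card_accepts_le [Fintype K] {m : ℕ} (hτ : Function.Injective τ) (hdeg : C.AxisDegree m δ) (hrule : C.Rule m)
    (O : ℕ → (V → K) → K) :
    ∀ (j i : ℕ), i + j ≤ m → ∀ (x : V → K) (v : K), v ≠ C.P i x →
      #{rs : Fin j → K | C.accepts τ O j i x v rs = true} ≤ bound (Fintype.card K) δ j
  | 0, i, _, x, v, hv => by
    have h0 : (univ.filter fun rs : Fin 0 → K => C.accepts τ O 0 i x v rs = true) = ∅ := by
      refine filter_eq_empty_iff.2 fun rs _ => ?_
      simpa [accepts] using fun h => hv h.symm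
    rw [h0, card_empty]
    exact Nat.zero_le _
  | j + 1, i, hij, x, v, hv => by
    have him : i < m := by omega
    obtain ⟨q₀, hq₀, hq₀P⟩ := hdeg i him x
    set q := interp τ fun l => O (i + 1) (Function.update x (C.a i) (τ l)) with hq_def
    have hq : q.natDegree ≤ δ := natDegree_interp_le τ hτ _
    rw [card_filter_succ_eq_sum, bound_succ]
    by_cases hchk : C.c i x (q.eval 0) (q.eval 1) = v
    · -- the consistency test passes, so `q ≠ q₀`
      have hne : q ≠ q₀ := by
        intro h
        apply hv
        rw [← hchk, h, ← hq₀P 0, ← hq₀P 1]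
        exact (hrule i him x).symm
      set Bad : Finset K := univ.filter fun r : K => q.eval r = q₀.eval r with hBad
      have hBad_card : #Bad ≤ δ := card_eval_eq_le hq hq₀ hne
      have hterm : ∀ r : K, #{t : Fin j → K | C.accepts τ O (j + 1) i x v (Fin.cons r t) = true} ≤
          if r ∈ Bad then Fintype.card K ^ j else bound (Fintype.card K) δ j := by
        intro r
        split_ifs with hr
        · refine (card_filter_le _ _).trans ?_
          rw [card_univ, Fintype.card_fun, Fintype.card_fin]
        · have hr' : q.eval r ≠ C.P (i + 1) (Function.update x (C.a i) r) := by
            rw [hq₀P r]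
            intro h
            exact hr (mem_filter.2 ⟨mem_univ _, h⟩)
          have hIH := card_accepts_le hτ hdeg hrule O j (i + 1) (by omega) (Function.update x (C.a i) r) (q.eval r) hr'
          refine le_trans (le_of_eq ?_) hIH
          congr 1
          ext t
          simp only [mem_filter, mem_univ, true_and, accepts_succ_cons, ← hq_def, hchk, decide_true,
            Bool.true_and]
      calc ∑ r : K, #{t : Fin j → K | C.accepts τ O (j + 1) i x v (Fin.cons r t) = true}
          ≤ ∑ r : K, (if r ∈ Bad then Fintype.card K ^ j else bound (Fintype.card K) δ j) := sum_le_sum fun r _ => hterm r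
        _ ≤ ∑ r ∈ Bad, Fintype.card K ^ j + ∑ r : K, bound (Fintype.card K) δ j := by
            rw [← sum_filter_add_sum_filter_not univ (· ∈ Bad)]
            refine Nat.add_le_add ?_ ?_
            · rw [sum_ite_of_true (fun r hr => (mem_filter.1 hr).2), filter_mem_eq_inter, univ_inter]
            · rw [sum_ite_of_false (fun r hr => (mem_filter.1 hr).2)]
              exact sum_le_sum_of_subset (filter_subset _ _)
        _ ≤ δ * Fintype.card K ^ j + Fintype.card K * bound (Fintype.card K) δ j := by
            rw [sum_const, sum_const, smul_eq_mul, smul_eq_mul, card_univ]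
            exact Nat.add_le_add_right (Nat.mul_le_mul_right _ hBad_card) _
    · -- the consistency test fails: nothing accepts
      have h0 : ∀ r : K, #{t : Fin j → K | C.accepts τ O (j + 1) i x v (Fin.cons r t) = true} = 0 := by
        intro r
        rw [card_eq_zero, filter_eq_empty_iff]
        intro t _
        simp [accepts_succ_cons, ← hq_def, hchk]
      simp [h0]

/-- **Soundness, probability form**: from a false claim, a uniformly random challenge vector in `Kʲ`
accepts with probability `≤ j δ / |K|` (the union bound over the `j` stages, AB (8.10)).
[cite: AroraBarakCC2009, Thm. 8.21 (Claim, (8.10))] [cite: LundEtAl1992, §3] -/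
theorem prob_accepts_le [Fintype K] {m : ℕ} (hτ : Function.Injective τ) (hdeg : C.AxisDegree m δ) (hrule : C.Rule m)
    (O : ℕ → (V → K) → K) {j i : ℕ} (hij : i + j ≤ m) (x : V → K) {v : K} (hv : v ≠ C.P i x) :
    (#{rs : Fin j → K | C.accepts τ O j i x v rs = true} : ℝ) / (Fintype.card K : ℝ) ^ j ≤
      (j * δ : ℝ) / Fintype.card K := by
  have hK : (0 : ℝ) < Fintype.card K := Nat.cast_pos.2 Fintype.card_pos
  have h := C.card_accepts_le τ hτ hdeg hrule O j i hij x v hv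
  cases j with
  | zero =>
    have h0 : #{rs : Fin 0 → K | C.accepts τ O 0 i x v rs = true} = 0 := by
      simpa [bound] using h
    rw [h0]
    simp
  | succ j =>
    rw [bound, Nat.add_sub_cancel] at h
    rw [div_le_div_iff₀ (pow_pos hK _) hK, pow_succ]
    have h' : (#{rs : Fin (j + 1) → K | C.accepts τ O (j + 1) i x v rs = true} : ℝ) ≤
        ((j + 1 : ℕ) * δ * Fintype.card K ^ j : ℕ) := Nat.cast_le.2 h
    push_cast at h' ⊢
    nlinarith [h', pow_nonneg hK.le j]

/-! ### The axis-degree hypothesis from a family of low total degree -/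

omit [DecidableEq K] in
/-- An axis line is a line: `x[a ↦ 0] + t · e_a = x[a ↦ t]`. [folklore] -/
theorem update_eq_line {k : ℕ} (x : Fin k → K) (a : Fin k) (t : K) :
    (fun l => Function.update x a 0 l + t * (Pi.single a (1 : K) : Fin k → K) l) = Function.update x a t := by
  funext l
  by_cases hl : l = a
  · subst hl; simp
  · simp [Function.update_of_ne hl, Pi.single_eq_of_ne hl]

omit [DecidableEq K] in
/-- **`AxisDegree` from total degree**: if every level `P (i+1)`, `i < m`, is (the evaluation of) a
multivariate polynomial of total degree `≤ δ`, the axis restrictions are polynomials of degree `≤ δ`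
(the line restriction `PolySelfCorrect.linePoly` along `e_{a i}`; for Trevisan–Vadhan's family
`totalDegree f_{n,i} ≤ Dn n`, `QBFUniv.totalDegree_fam_le`). [cite: AroraBarakCC2009, §19.4.2 (restriction of a degree-d polynomial to a line)] -/
theorem axisDegree_of_totalDegree {k : ℕ} (C : Chain K (Fin k)) {m : ℕ}
    (Q : ℕ → MvPolynomial (Fin k) K) (hQ : ∀ i < m, ∀ x, C.P (i + 1) x = MvPolynomial.eval x (Q (i + 1)))
    (hdeg : ∀ i < m, (Q (i + 1)).totalDegree ≤ δ) : C.AxisDegree m δ := by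
  intro i hi x
  refine ⟨PolySelfCorrect.linePoly (Q (i + 1)) (Function.update x (C.a i) 0) (Pi.single (C.a i) 1),
    PolySelfCorrect.natDegree_linePoly_le (hdeg i hi) _ _, fun t => ?_⟩
  rw [PolySelfCorrect.eval_linePoly, update_eq_line, hQ i hi]


omit [DecidableEq K] in
/-- **`AxisDegree` from per-variable degree** (the sharper hypothesis the small-field analysis
needs): if level `P (i+1)`, `i < m`, is a multivariate polynomial of degree `≤ δ` IN THE AXIS
VARIABLE `a i`, its axis restrictions have degree `≤ δ` (`QBFArith.restrict`,
`QBFArith.natDegree_restrict_le`; for Trevisan–Vadhan's family `degreeOf_fam_le` and, stage by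
stage, `degreeOf_opQ_le` / `degreeOf_foldr_lin_le`). [cite: AroraBarakCC2009, §8.3.3 ("Let `d` be an upper bound … on the degree of `U` with respect to `xᵢ`")] -/
theorem axisDegree_of_degreeOf {k : ℕ} (C : Chain K (Fin k)) {m : ℕ}
    (Q : ℕ → MvPolynomial (Fin k) K) (hQ : ∀ i < m, ∀ x, C.P (i + 1) x = MvPolynomial.eval x (Q (i + 1)))
    (hdeg : ∀ i < m, MvPolynomial.degreeOf (C.a i) (Q (i + 1)) ≤ δ) : C.AxisDegree m δ := by
  intro i hi x
  refine ⟨QBFArith.restrict (C.a i) x (Q (i + 1)), (QBFArith.natDegree_restrict_le _ _ _).trans (hdeg i hi),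
    fun t => ?_⟩
  rw [QBFArith.eval_restrict, hQ i hi]

/-! ### Stage-dependent degrees and the product form of soundness

When the field is only slightly larger than the degrees (Trevisan–Vadhan's `|K n| ≤ 2 (Dn n + 1)`,
`TVFunction.lean`), the union bound `j δ / |K|` is useless and two refinements are needed, both
standard: the verifier reads `δ i + 1` nodes at level `i`, `δ i` a bound on the degree of THAT axis
restriction (Arora–Barak §8.3.3: "`d` an upper bound on the degree of `U` with respect to `xᵢ`"), and
the soundness error is bounded in the product form `1 - ∏ᵢ (1 - δᵢ/|K|)` (Arora–Barak, Claim in the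
proof of Thm. 8.21: "`V` rejects with probability at least `(1 - d/p)ⁿ`", here with the stage's own
`dᵢ`), which independent repetitions then push below any constant. -/

section Varying

variable (ν : ℕ → K) (δs : ℕ → ℕ)

/-- The `δs i + 1` interpolation nodes used at level `i`: an initial segment of the node sequence `ν`.
[folklore] -/
def nodesAt (i : ℕ) : Fin (δs i + 1) → K := fun l => ν l

/-- The interpolant the verifier forms at level `i` from the point `x`: through the oracle's answers
for level `i + 1` at the `δs i + 1` nodes `ν 0, …, ν (δs i)` on the axis `a i`. [cite: AroraBarakCC2009, §8.3.3] -/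
def claimPoly (O : ℕ → (V → K) → K) (i : ℕ) (x : V → K) : K[X] :=
  interp (nodesAt ν δs i) fun l => O (i + 1) (Function.update x (C.a i) (ν l))

/-- **The verifier with stage-dependent node counts**: as `accepts`, but at level `i` the claimed
restriction of `P (i+1)` is interpolated from the oracle's answers at the `δs i + 1` nodes
`ν 0, …, ν (δs i)` (`claimPoly`). [cite: LundEtAl1992, §3] [cite: AroraBarakCC2009, §8.3.3] -/
def acceptsV (O : ℕ → (V → K) → K) : (j : ℕ) → ℕ → (V → K) → K → (Fin j → K) → Bool
  | 0, i, x, v, _ => decide (C.P i x = v)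
  | j + 1, i, x, v, rs =>
      decide (C.c i x ((C.claimPoly ν δs O i x).eval 0) ((C.claimPoly ν δs O i x).eval 1) = v) &&
        acceptsV O j (i + 1) (Function.update x (C.a i) (rs 0)) ((C.claimPoly ν δs O i x).eval (rs 0)) (Fin.tail rs)

/-- Unfolding at a `Fin.cons` challenge vector. [folklore] -/
theorem acceptsV_succ_cons (O : ℕ → (V → K) → K) (j i : ℕ) (x : V → K) (v r : K) (t : Fin j → K) :
    C.acceptsV ν δs O (j + 1) i x v (Fin.cons r t) =
      (decide (C.c i x ((C.claimPoly ν δs O i x).eval 0) ((C.claimPoly ν δs O i x).eval 1) = v) &&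
        C.acceptsV ν δs O j (i + 1) (Function.update x (C.a i) r) ((C.claimPoly ν δs O i x).eval r) t) := by
  simp only [acceptsV, Fin.cons_zero, Fin.tail_cons]

/-- **Axis-line low degree, stage by stage**: the restriction of `P (i+1)` along the axis `a i` has
degree `≤ δs i`. [cite: AroraBarakCC2009, §8.3.3] -/
def AxisDegreeV (m : ℕ) : Prop :=
  ∀ i < m, ∀ x : V → K, ∃ q : K[X], q.natDegree ≤ δs i ∧
    ∀ t : K, C.P (i + 1) (Function.update x (C.a i) t) = q.eval t

omit [DecidableEq K] in
/-- `AxisDegreeV` from per-variable degrees of a polynomial family. [cite: AroraBarakCC2009, §8.3.3] -/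
theorem axisDegreeV_of_degreeOf {k : ℕ} (C : Chain K (Fin k)) (δs : ℕ → ℕ) {m : ℕ}
    (Q : ℕ → MvPolynomial (Fin k) K) (hQ : ∀ i < m, ∀ x, C.P (i + 1) x = MvPolynomial.eval x (Q (i + 1)))
    (hdeg : ∀ i < m, MvPolynomial.degreeOf (C.a i) (Q (i + 1)) ≤ δs i) : C.AxisDegreeV δs m := by
  intro i hi x
  refine ⟨QBFArith.restrict (C.a i) x (Q (i + 1)), (QBFArith.natDegree_restrict_le _ _ _).trans (hdeg i hi),
    fun t => ?_⟩
  rw [QBFArith.eval_restrict, hQ i hi]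

/-- The node condition: at every level `i < m` the `δs i + 1` nodes are distinct. [folklore] -/
def NodesInj (m : ℕ) : Prop := ∀ i < m, Function.Injective (nodesAt ν δs i)

omit [Field K] [DecidableEq K] in
/-- Distinct nodes force `δs i + 1 ≤ |K|`. [folklore] -/
theorem succ_le_card_of_nodesInj [Fintype K] {m : ℕ} (hν : NodesInj ν δs m) {i : ℕ} (hi : i < m) :
    δs i + 1 ≤ Fintype.card K := by
  simpa using Fintype.card_le_of_injective _ (hν i hi)

/-- **Perfect completeness** of the stage-dependent verifier against an oracle truthful on the levels
`i+1, …, m`. [cite: LundEtAl1992, §3 (completeness)] -/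
theorem acceptsV_of_honest {m : ℕ} (hν : NodesInj ν δs m) (hdeg : C.AxisDegreeV δs m) (hrule : C.Rule m)
    (O : ℕ → (V → K) → K) :
    ∀ (j i : ℕ), i + j ≤ m → (∀ i', i < i' → i' ≤ m → ∀ y, O i' y = C.P i' y) →
      ∀ (x : V → K) (rs : Fin j → K), C.acceptsV ν δs O j i x (C.P i x) rs = true
  | 0, i, _, _, x, rs => by simp [acceptsV]
  | j + 1, i, hij, hO, x, rs => by
    have him : i < m := by omega
    obtain ⟨q, hq, hqP⟩ := hdeg i him x
    have hinterp : C.claimPoly ν δs O i x = q := by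
      have hvals : (fun l : Fin (δs i + 1) => O (i + 1) (Function.update x (C.a i) (ν l))) =
          fun l => q.eval (nodesAt ν δs i l) := by
        funext l
        rw [hO (i + 1) (Nat.lt_succ_self i) (by omega), hqP]; rfl
      rw [claimPoly, hvals]
      exact (eq_interp_of_natDegree_le _ (hν i him) hq).symm
    rw [← Fin.cons_self_tail rs, acceptsV_succ_cons, hinterp, Bool.and_eq_true, decide_eq_true_eq,
      ← hqP 0, ← hqP 1, ← hqP (rs 0)]
    refine ⟨(hrule i him x).symm, ?_⟩
    exact acceptsV_of_honest hν hdeg hrule O j (i + 1) (by omega)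
      (fun i' hi' hi'm y => hO i' (by omega) hi'm y) _ _

/-- Counting over `α × αʲ`, rejecting form: split the non-accepting vectors by their first entry. [folklore] -/
theorem card_filter_false_succ_eq_sum {α : Type*} [Fintype α] {j : ℕ} (Q : (Fin (j + 1) → α) → Bool) :
    #{rs : Fin (j + 1) → α | Q rs = false} = ∑ r : α, #{t : Fin j → α | Q (Fin.cons r t) = false} := by
  have h := card_filter_succ_eq_sum (fun rs => !Q rs)
  simp only [Bool.not_eq_true'] at h
  exact h

/-- **Soundness against a fixed oracle, product form**: from a FALSE claim `P i x = v`, at least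
`∏_{s<j} (|K| - δs (i+s))` of the `|K|ʲ` challenge vectors REJECT — at a level whose consistency test
passes the interpolant differs from the true restriction, so at least `|K| - δs i` challenges hand a
false claim down. [cite: AroraBarakCC2009, Thm. 8.21 (Claim: "`V` rejects with probability at least `(1-d/p)ⁿ`")] [cite: LundEtAl1992, §3 (soundness)] -/
theorem prod_le_card_rejectsV [Fintype K] {m : ℕ} (hν : NodesInj ν δs m) (hdeg : C.AxisDegreeV δs m)
    (hrule : C.Rule m) (O : ℕ → (V → K) → K) :
    ∀ (j i : ℕ), i + j ≤ m → ∀ (x : V → K) (v : K), v ≠ C.P i x →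
      ∏ s ∈ range j, (Fintype.card K - δs (i + s)) ≤ #{rs : Fin j → K | C.acceptsV ν δs O j i x v rs = false}
  | 0, i, _, x, v, hv => by
    rw [prod_range_zero]
    refine Nat.one_le_iff_ne_zero.2 (card_ne_zero.2 ⟨Fin.elim0, ?_⟩)
    rw [mem_filter]
    refine ⟨mem_univ _, ?_⟩
    simpa [acceptsV] using fun h : C.P i x = v => hv h.symm
  | j + 1, i, hij, x, v, hv => by
    have him : i < m := by omega
    obtain ⟨q₀, hq₀, hq₀P⟩ := hdeg i him x
    set q := C.claimPoly ν δs O i x with hq_def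
    have hq : q.natDegree ≤ δs i := natDegree_interp_le _ (hν i him) _
    rw [card_filter_false_succ_eq_sum]
    -- the product, first factor split off
    rw [prod_range_succ', Nat.add_zero, mul_comm]
    have hshift : ∏ s ∈ range j, (Fintype.card K - δs (i + (s + 1))) =
        ∏ s ∈ range j, (Fintype.card K - δs (i + 1 + s)) :=
      prod_congr rfl fun s _ => by rw [Nat.add_right_comm, Nat.add_assoc]
    rw [hshift]
    by_cases hchk : C.c i x (q.eval 0) (q.eval 1) = v
    · -- the consistency test passes, so `q ≠ q₀`
      have hne : q ≠ q₀ := by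
        intro h
        apply hv
        rw [← hchk, h, ← hq₀P 0, ← hq₀P 1]
        exact (hrule i him x).symm
      set Bad : Finset K := univ.filter fun r : K => q.eval r = q₀.eval r with hBad
      have hBad_card : #Bad ≤ δs i := card_eval_eq_le hq hq₀ hne
      have hGood_card : Fintype.card K - δs i ≤ #(univ.filter fun r : K => r ∉ Bad) := by
        have h1 : #Bad + #(univ.filter fun r : K => r ∉ Bad) = Fintype.card K := by
          have h2 := Finset.card_filter_add_card_filter_not (s := (univ : Finset K)) (fun r : K => r ∈ Bad)
          rw [filter_mem_eq_inter, univ_inter, card_univ] at h2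
          exact h2
        omega
      have hterm : ∀ r : K, r ∉ Bad → ∏ s ∈ range j, (Fintype.card K - δs (i + 1 + s)) ≤
          #{t : Fin j → K | C.acceptsV ν δs O (j + 1) i x v (Fin.cons r t) = false} := by
        intro r hr
        have hr' : q.eval r ≠ C.P (i + 1) (Function.update x (C.a i) r) := by
          rw [hq₀P r]
          intro h
          exact hr (mem_filter.2 ⟨mem_univ _, h⟩)
        have hIH := prod_le_card_rejectsV hν hdeg hrule O j (i + 1) (by omega) (Function.update x (C.a i) r)
          (q.eval r) hr'
        refine hIH.trans (le_of_eq ?_)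
        congr 1
        ext t
        simp only [mem_filter, mem_univ, true_and, acceptsV_succ_cons, ← hq_def, hchk, decide_true,
          Bool.true_and]
      calc (Fintype.card K - δs i) * ∏ s ∈ range j, (Fintype.card K - δs (i + 1 + s))
          ≤ #(univ.filter fun r : K => r ∉ Bad) * ∏ s ∈ range j, (Fintype.card K - δs (i + 1 + s)) :=
            Nat.mul_le_mul_right _ hGood_card
        _ = ∑ r ∈ univ.filter (fun r : K => r ∉ Bad), ∏ s ∈ range j, (Fintype.card K - δs (i + 1 + s)) := by
            rw [sum_const, smul_eq_mul]
        _ ≤ ∑ r ∈ univ.filter (fun r : K => r ∉ Bad),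
              #{t : Fin j → K | C.acceptsV ν δs O (j + 1) i x v (Fin.cons r t) = false} :=
            sum_le_sum fun r hr => hterm r (mem_filter.1 hr).2
        _ ≤ ∑ r : K, #{t : Fin j → K | C.acceptsV ν δs O (j + 1) i x v (Fin.cons r t) = false} :=
            sum_le_sum_of_subset (filter_subset _ _)
    · -- the consistency test fails: everything rejects
      have hall : ∀ r : K, #{t : Fin j → K | C.acceptsV ν δs O (j + 1) i x v (Fin.cons r t) = false} =
          Fintype.card K ^ j := by
        intro r
        rw [← Fintype.card_fin j, ← Fintype.card_fun, Fintype.card_fin, ← card_univ]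
        congr 1
        refine filter_true_of_mem fun t _ => ?_
        simp [acceptsV_succ_cons, ← hq_def, hchk]
      simp only [hall, sum_const, card_univ, smul_eq_mul]
      calc (Fintype.card K - δs i) * ∏ s ∈ range j, (Fintype.card K - δs (i + 1 + s))
          ≤ Fintype.card K * ∏ _s ∈ range j, Fintype.card K :=
            Nat.mul_le_mul (Nat.sub_le _ _) (prod_le_prod' fun s _ => Nat.sub_le _ _)
        _ = Fintype.card K * Fintype.card K ^ j := by rw [prod_const, card_range]

/-- **Soundness count, complement form**: accepting vectors plus `∏ (|K| - δs)` fit into `|K|ʲ`. [cite: AroraBarakCC2009, Thm. 8.21 (Claim)] -/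
theorem card_acceptsV_add_prod_le [Fintype K] {m : ℕ} (hν : NodesInj ν δs m) (hdeg : C.AxisDegreeV δs m)
    (hrule : C.Rule m) (O : ℕ → (V → K) → K) {j i : ℕ} (hij : i + j ≤ m) (x : V → K) {v : K}
    (hv : v ≠ C.P i x) :
    #{rs : Fin j → K | C.acceptsV ν δs O j i x v rs = true} + ∏ s ∈ range j, (Fintype.card K - δs (i + s)) ≤
      Fintype.card K ^ j := by
  have h := C.prod_le_card_rejectsV ν δs hν hdeg hrule O j i hij x v hv
  have htot : #{rs : Fin j → K | C.acceptsV ν δs O j i x v rs = true} +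
      #{rs : Fin j → K | C.acceptsV ν δs O j i x v rs = false} = Fintype.card K ^ j := by
    have := Finset.card_filter_add_card_filter_not (s := (univ : Finset (Fin j → K)))
      (fun rs => C.acceptsV ν δs O j i x v rs = true)
    simp only [Bool.not_eq_true] at this
    rw [this, card_univ, Fintype.card_fun, Fintype.card_fin]
  omega

/-- **Soundness, probability form (product bound)**: from a false claim a uniformly random challenge
vector accepts with probability `≤ 1 - ∏_{s<j} (1 - δs (i+s) / |K|)`.
[cite: AroraBarakCC2009, Thm. 8.21 (Claim: "`V` rejects with probability at least `(1-d/p)ⁿ`")] -/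
theorem prob_acceptsV_le [Fintype K] {m : ℕ} (hν : NodesInj ν δs m) (hdeg : C.AxisDegreeV δs m)
    (hrule : C.Rule m) (O : ℕ → (V → K) → K) {j i : ℕ} (hij : i + j ≤ m) (x : V → K) {v : K}
    (hv : v ≠ C.P i x) :
    (#{rs : Fin j → K | C.acceptsV ν δs O j i x v rs = true} : ℝ) / (Fintype.card K : ℝ) ^ j ≤
      1 - ∏ s ∈ range j, (1 - (δs (i + s) : ℝ) / Fintype.card K) := by
  have hK : (0 : ℝ) < Fintype.card K := Nat.cast_pos.2 Fintype.card_pos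
  have hKj : (0 : ℝ) < (Fintype.card K : ℝ) ^ j := pow_pos hK j
  have h := C.card_acceptsV_add_prod_le ν δs hν hdeg hrule O hij x hv
  -- every factor is a genuine difference: `δs (i+s) ≤ |K|`
  have hle : ∀ s ∈ range j, δs (i + s) ≤ Fintype.card K := fun s hs =>
    (Nat.le_succ _).trans (succ_le_card_of_nodesInj ν δs hν (by rw [mem_range] at hs; omega))
  have hcast : ((∏ s ∈ range j, (Fintype.card K - δs (i + s)) : ℕ) : ℝ) =
      (Fintype.card K : ℝ) ^ j * ∏ s ∈ range j, (1 - (δs (i + s) : ℝ) / Fintype.card K) := by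
    rw [Nat.cast_prod]
    have hfac : ∀ s ∈ range j, (((Fintype.card K - δs (i + s) : ℕ)) : ℝ) =
        (Fintype.card K : ℝ) * (1 - (δs (i + s) : ℝ) / Fintype.card K) := fun s hs => by
      rw [Nat.cast_sub (hle s hs), mul_sub, mul_one, mul_div_cancel₀ _ hK.ne']
    rw [prod_congr rfl hfac, prod_mul_distrib, prod_const, card_range]
  have h' : (#{rs : Fin j → K | C.acceptsV ν δs O j i x v rs = true} : ℝ) +
      (Fintype.card K : ℝ) ^ j * ∏ s ∈ range j, (1 - (δs (i + s) : ℝ) / Fintype.card K) ≤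
        (Fintype.card K : ℝ) ^ j := by
    rw [← hcast]; exact_mod_cast h
  rw [div_le_iff₀ hKj]
  have hcomm : (1 - ∏ s ∈ range j, (1 - (δs (i + s) : ℝ) / Fintype.card K)) * (Fintype.card K : ℝ) ^ j =
      (Fintype.card K : ℝ) ^ j -
        (Fintype.card K : ℝ) ^ j * ∏ s ∈ range j, (1 - (δs (i + s) : ℝ) / Fintype.card K) := by ring
  rw [hcomm]
  linarith [h']

/-! ### From the product bound to a constant: `1 - x ≥ 4^{-x}` on `[0, 1/2]` -/

/-- `exp (-2x·log 2) = 4^{-x} ≤ 1 - x` for `0 ≤ x ≤ 1/2` (convexity of `exp`: the chord from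
`(0, 1)` to `(-log 2, 1/2)` lies above the graph). [folklore] -/
theorem exp_neg_le_one_sub {x : ℝ} (h0 : 0 ≤ x) (h1 : x ≤ 1 / 2) :
    Real.exp (-(2 * x * Real.log 2)) ≤ 1 - x := by
  have hconv := (convexOn_exp).2 (Set.mem_univ (0 : ℝ)) (Set.mem_univ (-Real.log 2))
    (show (0 : ℝ) ≤ 1 - 2 * x by linarith) (show (0 : ℝ) ≤ 2 * x by linarith) (by ring)
  simp only [smul_eq_mul, mul_zero, zero_add, Real.exp_zero, mul_one, Real.exp_neg,
    Real.exp_log two_pos] at hconv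
  have e : -(2 * x * Real.log 2) = 2 * x * -Real.log 2 := by ring
  rw [e]
  have h2 : (2 : ℝ)⁻¹ = 1 / 2 := by norm_num
  rw [h2] at hconv
  linarith

/-- **Weierstrass-type product bound**: `∏ (1 - xᵢ) ≥ 4^{-Σ xᵢ}` for `xᵢ ∈ [0, 1/2]`. [folklore] -/
theorem exp_neg_sum_le_prod_one_sub {ι : Type*} (s : Finset ι) (x : ι → ℝ) (h0 : ∀ i ∈ s, 0 ≤ x i)
    (h1 : ∀ i ∈ s, x i ≤ 1 / 2) :
    Real.exp (-(2 * (∑ i ∈ s, x i) * Real.log 2)) ≤ ∏ i ∈ s, (1 - x i) := by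
  have e : -(2 * (∑ i ∈ s, x i) * Real.log 2) = ∑ i ∈ s, (-(2 * x i * Real.log 2)) := by
    rw [mul_sum, sum_mul, ← sum_neg_distrib]
  rw [e, Real.exp_sum]
  exact prod_le_prod (fun i _ => (Real.exp_pos _).le) fun i hi => exp_neg_le_one_sub (h0 i hi) (h1 i hi)

/-- With `Σ xᵢ ≤ 5/2` and `xᵢ ∈ [0, 1/2]`: `∏ (1 - xᵢ) ≥ 4^{-5/2} = 1/32`. [folklore] -/
theorem one_div_le_prod_one_sub {ι : Type*} (s : Finset ι) (x : ι → ℝ) (h0 : ∀ i ∈ s, 0 ≤ x i)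
    (h1 : ∀ i ∈ s, x i ≤ 1 / 2) (hsum : ∑ i ∈ s, x i ≤ 5 / 2) :
    (1 : ℝ) / 32 ≤ ∏ i ∈ s, (1 - x i) := by
  refine le_trans ?_ (exp_neg_sum_le_prod_one_sub s x h0 h1)
  have h32 : Real.exp (-(5 * Real.log 2)) = 1 / 32 := by
    rw [Real.exp_neg, show (5 : ℝ) * Real.log 2 = ((5 : ℕ) : ℝ) * Real.log 2 by norm_num, Real.exp_nat_mul,
      Real.exp_log two_pos]
    norm_num
  rw [← h32]
  exact Real.exp_le_exp.2 (by nlinarith [Real.log_pos one_lt_two])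

/-- **Soundness below a constant at a small field**: if the stage degrees satisfy
`2 Σ_{s<j} δs (i+s) ≤ 5 |K|` and `2 δs (i+s) ≤ |K|`, a false claim is accepted with probability
`≤ 31/32` (product form and `∏ (1 - δᵢ/|K|) ≥ 1/32`). [cite: AroraBarakCC2009, Thm. 8.21 (Claim)] -/
theorem prob_acceptsV_le_const [Fintype K] {m : ℕ} (hν : NodesInj ν δs m) (hdeg : C.AxisDegreeV δs m)
    (hrule : C.Rule m) (O : ℕ → (V → K) → K) {j i : ℕ} (hij : i + j ≤ m)
    (hsum : 2 * ∑ s ∈ range j, δs (i + s) ≤ 5 * Fintype.card K)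
    (hhalf : ∀ s < j, 2 * δs (i + s) ≤ Fintype.card K) (x : V → K) {v : K} (hv : v ≠ C.P i x) :
    (#{rs : Fin j → K | C.acceptsV ν δs O j i x v rs = true} : ℝ) / (Fintype.card K : ℝ) ^ j ≤ 31 / 32 := by
  have hK : (0 : ℝ) < Fintype.card K := Nat.cast_pos.2 Fintype.card_pos
  refine (C.prob_acceptsV_le ν δs hν hdeg hrule O hij x hv).trans ?_
  have hprod := one_div_le_prod_one_sub (range j) (fun s => (δs (i + s) : ℝ) / Fintype.card K)
    (fun s _ => div_nonneg (Nat.cast_nonneg _) hK.le)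
    (fun s hs => by
      rw [div_le_iff₀ hK]
      have := hhalf s (mem_range.1 hs)
      have : (2 * δs (i + s) : ℝ) ≤ Fintype.card K := by exact_mod_cast this
      linarith)
    (by
      rw [← sum_div, div_le_iff₀ hK]
      have : (2 * ∑ s ∈ range j, δs (i + s) : ℝ) ≤ 5 * Fintype.card K := by exact_mod_cast hsum
      push_cast at this
      linarith)
  linarith

/-! ### The checker's run: the first claim is read off the oracle -/

/-- **One run of the downward checker from a point with no claim in hand** (the use in a membership
checker: the claim to be verified is a PREDICATE `good` of the value `P i x`, e.g. "bit `j` is `1`"):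
with no deeper level (`j = 0`) evaluate the level itself; otherwise take as the claim the value the
rule assigns to the oracle's level-`(i+1)` interpolant, test `good` on it, and verify it down the chain.
[cite: LundEtAl1992, §3] [cite: Santhanam2009, Lemma 12] -/
def checksV (O : ℕ → (V → K) → K) (good : K → Bool) : (j : ℕ) → ℕ → (V → K) → (Fin j → K) → Bool
  | 0, i, x, _ => good (C.P i x)
  | j + 1, i, x, rs =>
      good (C.c i x ((C.claimPoly ν δs O i x).eval 0) ((C.claimPoly ν δs O i x).eval 1)) &&
        C.acceptsV ν δs O (j + 1) i x
          (C.c i x ((C.claimPoly ν δs O i x).eval 0) ((C.claimPoly ν δs O i x).eval 1)) rs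

/-- **Completeness of a run**: against an oracle truthful on the levels `i+1, …, m`, the run returns
exactly `good (P i x)` (it accepts the true claims and only those). [cite: LundEtAl1992, §3 (completeness)] -/
theorem checksV_of_honest {m : ℕ} (hν : NodesInj ν δs m) (hdeg : C.AxisDegreeV δs m) (hrule : C.Rule m)
    (O : ℕ → (V → K) → K) (good : K → Bool) {j i : ℕ} (hij : i + j ≤ m)
    (hO : ∀ i', i < i' → i' ≤ m → ∀ y, O i' y = C.P i' y) (x : V → K) (rs : Fin j → K) :
    C.checksV ν δs O good j i x rs = good (C.P i x) := by
  cases j with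
  | zero => rfl
  | succ j =>
    have him : i < m := by omega
    obtain ⟨q, hq, hqP⟩ := hdeg i him x
    have hinterp : C.claimPoly ν δs O i x = q := by
      have hvals : (fun l : Fin (δs i + 1) => O (i + 1) (Function.update x (C.a i) (ν l))) =
          fun l => q.eval (nodesAt ν δs i l) := by
        funext l
        rw [hO (i + 1) (Nat.lt_succ_self i) (by omega), hqP]; rfl
      rw [claimPoly, hvals]
      exact (eq_interp_of_natDegree_le _ (hν i him) hq).symm
    have hval : C.c i x ((C.claimPoly ν δs O i x).eval 0) ((C.claimPoly ν δs O i x).eval 1) = C.P i x := by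
      rw [hinterp, ← hqP 0, ← hqP 1]; exact (hrule i him x).symm
    rw [checksV, hval, C.acceptsV_of_honest ν δs hν hdeg hrule O (j + 1) i hij hO x rs, Bool.and_true]

/-- **Soundness of a run**: if the true value fails `good`, the accepting challenge vectors plus
`∏ (|K| - δs)` fit into `|K|ʲ` (an accepting run holds a `good`, hence false, claim). [cite: AroraBarakCC2009, Thm. 8.21 (Claim)] [cite: Santhanam2009, Lemma 12 (3)] -/
theorem card_checksV_add_prod_le [Fintype K] {m : ℕ} (hν : NodesInj ν δs m) (hdeg : C.AxisDegreeV δs m)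
    (hrule : C.Rule m) (O : ℕ → (V → K) → K) (good : K → Bool) {j i : ℕ} (hij : i + j ≤ m) (x : V → K)
    (hbad : good (C.P i x) = false) :
    #{rs : Fin j → K | C.checksV ν δs O good j i x rs = true} + ∏ s ∈ range j, (Fintype.card K - δs (i + s)) ≤
      Fintype.card K ^ j := by
  cases j with
  | zero =>
    have h0 : #{rs : Fin 0 → K | C.checksV ν δs O good 0 i x rs = true} = 0 := by
      rw [card_eq_zero, filter_eq_empty_iff]
      intro rs _
      simp [checksV, hbad]
    rw [h0, prod_range_zero, pow_zero]; norm_num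
  | succ j =>
    set v := C.c i x ((C.claimPoly ν δs O i x).eval 0) ((C.claimPoly ν δs O i x).eval 1) with hv_def
    by_cases hgood : good v = true
    · have hv : v ≠ C.P i x := fun h => by rw [h, hbad] at hgood; exact Bool.false_ne_true hgood
      refine le_trans (Nat.add_le_add_right (card_le_card ?_) _)
        (C.card_acceptsV_add_prod_le ν δs hν hdeg hrule O hij x hv)
      intro rs
      simp only [mem_filter, mem_univ, true_and, checksV, ← hv_def, Bool.and_eq_true]
      exact fun h => h.2
    · have h0 : #{rs : Fin (j + 1) → K | C.checksV ν δs O good (j + 1) i x rs = true} = 0 := by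
        rw [card_eq_zero, filter_eq_empty_iff]
        intro rs _
        simp only [checksV, ← hv_def, Bool.and_eq_true, not_and]
        exact fun h => absurd h hgood
      rw [h0, zero_add]
      have hν' : ∀ s ∈ range (j + 1), δs (i + s) ≤ Fintype.card K := fun s hs =>
        (Nat.le_succ _).trans (succ_le_card_of_nodesInj ν δs hν (by rw [mem_range] at hs; omega))
      calc ∏ s ∈ range (j + 1), (Fintype.card K - δs (i + s))
          ≤ ∏ _s ∈ range (j + 1), Fintype.card K := prod_le_prod' fun s _ => Nat.sub_le _ _
        _ = Fintype.card K ^ (j + 1) := by rw [prod_const, card_range]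

/-- **Soundness of a run below a constant** (small field): probability `≤ 31/32`. [cite: AroraBarakCC2009, Thm. 8.21 (Claim)] -/
theorem prob_checksV_le_const [Fintype K] {m : ℕ} (hν : NodesInj ν δs m) (hdeg : C.AxisDegreeV δs m)
    (hrule : C.Rule m) (O : ℕ → (V → K) → K) (good : K → Bool) {j i : ℕ} (hij : i + j ≤ m)
    (hsum : 2 * ∑ s ∈ range j, δs (i + s) ≤ 5 * Fintype.card K)
    (hhalf : ∀ s < j, 2 * δs (i + s) ≤ Fintype.card K) (x : V → K) (hbad : good (C.P i x) = false) :
    (#{rs : Fin j → K | C.checksV ν δs O good j i x rs = true} : ℝ) / (Fintype.card K : ℝ) ^ j ≤ 31 / 32 := by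
  have hK : (0 : ℝ) < Fintype.card K := Nat.cast_pos.2 Fintype.card_pos
  have hKj : (0 : ℝ) < (Fintype.card K : ℝ) ^ j := pow_pos hK j
  have h := C.card_checksV_add_prod_le ν δs hν hdeg hrule O good hij x hbad
  have hle : ∀ s ∈ range j, δs (i + s) ≤ Fintype.card K := fun s hs =>
    (Nat.le_succ _).trans (succ_le_card_of_nodesInj ν δs hν (by rw [mem_range] at hs; omega))
  have hcast : ((∏ s ∈ range j, (Fintype.card K - δs (i + s)) : ℕ) : ℝ) =
      (Fintype.card K : ℝ) ^ j * ∏ s ∈ range j, (1 - (δs (i + s) : ℝ) / Fintype.card K) := by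
    rw [Nat.cast_prod]
    have hfac : ∀ s ∈ range j, (((Fintype.card K - δs (i + s) : ℕ)) : ℝ) =
        (Fintype.card K : ℝ) * (1 - (δs (i + s) : ℝ) / Fintype.card K) := fun s hs => by
      rw [Nat.cast_sub (hle s hs), mul_sub, mul_one, mul_div_cancel₀ _ hK.ne']
    rw [prod_congr rfl hfac, prod_mul_distrib, prod_const, card_range]
  have hprod := one_div_le_prod_one_sub (range j) (fun s => (δs (i + s) : ℝ) / Fintype.card K)
    (fun s _ => div_nonneg (Nat.cast_nonneg _) hK.le)
    (fun s hs => by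
      rw [div_le_iff₀ hK]
      have := hhalf s (mem_range.1 hs)
      have : (2 * δs (i + s) : ℝ) ≤ Fintype.card K := by exact_mod_cast this
      linarith)
    (by
      rw [← sum_div, div_le_iff₀ hK]
      have : (2 * ∑ s ∈ range j, δs (i + s) : ℝ) ≤ 5 * Fintype.card K := by exact_mod_cast hsum
      push_cast at this
      linarith)
  have h' : (#{rs : Fin j → K | C.checksV ν δs O good j i x rs = true} : ℝ) +
      (Fintype.card K : ℝ) ^ j * ∏ s ∈ range j, (1 - (δs (i + s) : ℝ) / Fintype.card K) ≤
        (Fintype.card K : ℝ) ^ j := by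
    rw [← hcast]; exact_mod_cast h
  rw [div_le_iff₀ hKj]
  nlinarith [h', hprod, hKj]

/-! ### Independent repetitions against a fixed oracle -/

/-- Vectors of `k` independent blocks all in `A` number `|A|ᵏ`. [folklore] -/
theorem card_forall_mem_eq_pow {α : Type*} [Fintype α] [DecidableEq α] (A : Finset α) (k : ℕ) :
    #{R : Fin k → α | ∀ t, R t ∈ A} = #A ^ k := by
  have h : (univ.filter fun R : Fin k → α => ∀ t, R t ∈ A) = Fintype.piFinset fun _ : Fin k => A := by
    ext R
    simp [Fintype.mem_piFinset]
  rw [h, Fintype.card_piFinset, prod_const, card_univ, Fintype.card_fin]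

/-- **Repetition**: if one run accepts a bad input with probability `≤ c`, then `k` runs on
independent challenge blocks, all required to accept, do so with probability `≤ cᵏ` (the oracle is a
FIXED function, so the runs are independent events). [cite: Santhanam2009, Lemma 12 (3) ("rejects with probability at least 1/2")] [cite: AroraBarakCC2009, §7.4.1 (error reduction by repetition)] -/
theorem prob_forall_le_pow {α : Type*} [Fintype α] [DecidableEq α] [Nonempty α] (Q : α → Bool) {c : ℝ}
    (hc : (#{r : α | Q r = true} : ℝ) / Fintype.card α ≤ c) (k : ℕ) :
    (#{R : Fin k → α | ∀ t, Q (R t) = true} : ℝ) / (Fintype.card α : ℝ) ^ k ≤ c ^ k := by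
  have hα : (0 : ℝ) < Fintype.card α := Nat.cast_pos.2 Fintype.card_pos
  have h := card_forall_mem_eq_pow (univ.filter fun r : α => Q r = true) k
  have h' : #{R : Fin k → α | ∀ t, Q (R t) = true} = #{r : α | Q r = true} ^ k := by
    rw [← h]
    congr 1
    ext R
    simp
  rw [h', Nat.cast_pow, ← div_pow]
  exact pow_le_pow_left₀ (div_nonneg (Nat.cast_nonneg _) hα.le) hc k

/-- `(31/32)⁶⁴ ≤ 1/3`: sixty-four repetitions turn the small-field constant into the checker's `1/3`. [folklore] -/
theorem const_pow_64_le : ((31 : ℝ) / 32) ^ 64 ≤ 1 / 3 := by norm_num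

/-- **The repeated run is `1/3`-sound**: `64` runs of `checksV` on independent challenge blocks, all
required to accept, accept an input whose true value fails `good` with probability `≤ 1/3`, against
every fixed oracle, at a field with `2 Σ δs ≤ 5 |K|`, `2 δs ≤ |K|`. [cite: Santhanam2009, Lemma 12 (3)] [cite: AroraBarakCC2009, Thm. 8.21 (Claim)] -/
theorem prob_forall_checksV_le [Fintype K] {m : ℕ} (hν : NodesInj ν δs m) (hdeg : C.AxisDegreeV δs m)
    (hrule : C.Rule m) (O : ℕ → (V → K) → K) (good : K → Bool) {j i : ℕ} (hij : i + j ≤ m)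
    (hsum : 2 * ∑ s ∈ range j, δs (i + s) ≤ 5 * Fintype.card K)
    (hhalf : ∀ s < j, 2 * δs (i + s) ≤ Fintype.card K) (x : V → K) (hbad : good (C.P i x) = false) :
    (#{R : Fin 64 → (Fin j → K) | ∀ t, C.checksV ν δs O good j i x (R t) = true} : ℝ) /
        ((Fintype.card K : ℝ) ^ j) ^ 64 ≤ 1 / 3 := by
  have h := prob_forall_le_pow (fun rs : Fin j → K => C.checksV ν δs O good j i x rs)
    (c := 31 / 32) (by
      rw [Fintype.card_fun, Fintype.card_fin, Nat.cast_pow]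
      exact C.prob_checksV_le_const ν δs hν hdeg hrule O good hij hsum hhalf x hbad) 64
  rw [Fintype.card_fun, Fintype.card_fin, Nat.cast_pow] at h
  exact h.trans const_pow_64_le

end Varying

end Chain

end ChainCheck

end Literature.Computability.Complexity

end
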